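import Summits.CriticalPhenomena.PercolationContinuityZ3.Theorems.PercNearOneGluingAdditiveGluingChartPPointwise
import HarnessLib

/-!
# Crux `PercNearOneGluing.AdditiveGluing` (stmt-CriticalPhenomena-4576): CHART P of the refined-coordinate atlas —
# the three-relay E-form when the pair attachment φ'₁₂ ≤ 1/2 and the three single attachments are ≤ 3/4
# (seat (d) exchange-certificate form, gen 3)

Support file (`--supports stmt-CriticalPhenomena-4576`); no definitions, no named facts, no sorries.

Refined attachments of the observer `o` (seat (d) gen 2): `φ'_S = μ(S ↔ o | S ∪ {o} ↮ A ∖ S)` for `S ⊆ A = {a₁,a₂,a₃}`.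
The landed charts B–M cover every instance in which at least two of the six refined attachments are `≤ 1/2`.  This chart is
the first one for the residual class "exactly one PAIR attachment small": **for three relays with `a₃` worst, `τ₁ ≤ τ₂` and
`m₂₃ ≤ m₁` (the bad-region consequence used by charts H/I/K), if `φ'₁₂ ≤ 1/2` and `φ'₁, φ'₂, φ'₃ ≤ 3/4` then
`μ(o ↔ A ∖ o ↔ b) ≤ μ(a₃ ↮ b)`** — no lower bounds, no tie, no condition on `τ(o)`.  Certificate (13 constant rational multipliers,
found by the seat's box LP and verified exactly at the 16 vertices of the parameter box): two refined cross atoms with the pair event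
(`chart_crossAll`, sources `{a₁,o}`, `{a₂,o}`), ONE refined diagonal atom (`chartP_diagOne`, new: van den Berg–Häggström–Kahn Thm 1.3
for the cluster of `{a₃,o}` given `{a₃,o} ↮ {a₁,a₂}`, events `{a₃↔o}` and `{a₃↔b}`), seven Kozma–Nitzan Lemma-3 exchanges
(`stub_exchangePlain/Has/Avoid_c7`), the region row `m₂₃ ≤ m₁`, and the identities defining `φ'₃`, `φ'₁₂`.
[cite: KozmaNitzan2024, Theorem 2 (§3.1, pp. 8–9), Lemma 3 (pp. 6–7); VandenbergHaggstromKahn2005, Thm. 1.3, Thm. 1.4 (p. 7)]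
-/

namespace Summit.CriticalPhenomena.PercolationContinuityZ3.Theorems

open MeasureTheory Set Literature.Probability.LatticeModels Literature.Probability.Percolation
open scoped Classical

set_option maxHeartbeats 4000000 in
/-- **Chart P** (`a₃` worst, `τ₁ ≤ τ₂`, `m₂₃ ≤ m₁`): refined attachments `φ'₁, φ'₂, φ'₃ ≤ 3/4` and `φ'₁₂ ≤ 1/2` ⇒ `μ((o↔a₁ ∪ o↔a₂ ∪ o↔a₃) ∖ o↔b) ≤ μ(a₃ ↮ b)` (division-free box hypotheses `4·μ(N'ᵢ ∩ {aᵢ↔o}) ≤ 3·μ(N'ᵢ)`, `2·μ(N'₁₂ ∩ {a₁↔o ∪ a₂↔o}) ≤ μ(N'₁₂)`).  13-term constant-multiplier certificate. [cite: KozmaNitzan2024, Theorem 2 (§3.1, pp. 8–9), Lemma 3 (pp. 6–7); VandenbergHaggstromKahn2005, Thm. 1.3, Thm. 1.4 (p. 7)] -/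
theorem eform3_chartP {n : ℕ} (w : Sym2 (Fin n) → unitInterval) (o b a₁ a₂ a₃ : Fin n)
    (h12 : a₁ ≠ a₂) (h13 : a₁ ≠ a₃) (h23 : a₂ ≠ a₃) (ho1 : o ≠ a₁) (ho2 : o ≠ a₂) (ho3 : o ≠ a₃)
    (hτ31 : (prodBernoulli w).real (openConn a₃ b) ≤ (prodBernoulli w).real (openConn a₁ b))
    (hτ32 : (prodBernoulli w).real (openConn a₃ b) ≤ (prodBernoulli w).real (openConn a₂ b))
    (hτ12 : (prodBernoulli w).real (openConn a₁ b) ≤ (prodBernoulli w).real (openConn a₂ b))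
    (hB₁ : 4 * (prodBernoulli w).real ((openConn a₁ a₂)ᶜ ∩ (openConn a₁ a₃)ᶜ ∩ ((openConn o a₂)ᶜ ∩ (openConn o a₃)ᶜ) ∩ openConn a₁ o) ≤
      3 * (prodBernoulli w).real ((openConn a₁ a₂)ᶜ ∩ (openConn a₁ a₃)ᶜ ∩ ((openConn o a₂)ᶜ ∩ (openConn o a₃)ᶜ)))
    (hB₂ : 4 * (prodBernoulli w).real ((openConn a₂ a₁)ᶜ ∩ (openConn a₂ a₃)ᶜ ∩ ((openConn o a₁)ᶜ ∩ (openConn o a₃)ᶜ) ∩ openConn a₂ o) ≤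
      3 * (prodBernoulli w).real ((openConn a₂ a₁)ᶜ ∩ (openConn a₂ a₃)ᶜ ∩ ((openConn o a₁)ᶜ ∩ (openConn o a₃)ᶜ)))
    (hB₃ : 4 * (prodBernoulli w).real ((openConn a₃ a₁)ᶜ ∩ (openConn a₃ a₂)ᶜ ∩ ((openConn o a₁)ᶜ ∩ (openConn o a₂)ᶜ) ∩ openConn a₃ o) ≤
      3 * (prodBernoulli w).real ((openConn a₃ a₁)ᶜ ∩ (openConn a₃ a₂)ᶜ ∩ ((openConn o a₁)ᶜ ∩ (openConn o a₂)ᶜ)))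
    (hB₁₂ : 2 * (prodBernoulli w).real ((openConn a₁ a₃)ᶜ ∩ (openConn a₂ a₃)ᶜ ∩ (openConn o a₃)ᶜ ∩ (openConn a₁ o ∪ openConn a₂ o)) ≤
      (prodBernoulli w).real ((openConn a₁ a₃)ᶜ ∩ (openConn a₂ a₃)ᶜ ∩ (openConn o a₃)ᶜ))
    (hreg : (prodBernoulli w).real (openConn b a₂ ∩ openConn b a₃ ∩ (openConn b a₁)ᶜ) ≤
      (prodBernoulli w).real (openConn b a₁ ∩ (openConn b a₂)ᶜ ∩ (openConn b a₃)ᶜ)) :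
    (prodBernoulli w).real ((openConn o a₁ ∪ openConn o a₂ ∪ openConn o a₃) \ openConn o b) ≤
      (prodBernoulli w).real ((openConn a₃ b)ᶜ) := by
  set p₁ := (prodBernoulli w).real ((openConn a₁ a₂)ᶜ ∩ (openConn a₁ a₃)ᶜ ∩ ((openConn o a₂)ᶜ ∩ (openConn o a₃)ᶜ) ∩ openConn a₁ o) /
    (prodBernoulli w).real ((openConn a₁ a₂)ᶜ ∩ (openConn a₁ a₃)ᶜ ∩ ((openConn o a₂)ᶜ ∩ (openConn o a₃)ᶜ)) with hp₁def
  have hp₁0 : 0 ≤ p₁ := div_nonneg measureReal_nonneg measureReal_nonneg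
  have hp₁le : p₁ ≤ 3 / 4 := by
    rcases eq_or_lt_of_le (measureReal_nonneg (μ := prodBernoulli w)
      (s := (openConn a₁ a₂)ᶜ ∩ (openConn a₁ a₃)ᶜ ∩ ((openConn o a₂)ᶜ ∩ (openConn o a₃)ᶜ))) with hz | hpos
    · rw [hp₁def, ← hz, div_zero]; norm_num
    · rw [hp₁def, div_le_iff₀ hpos]; linarith
  have hidp₁ : (prodBernoulli w).real ((openConn a₁ a₂)ᶜ ∩ (openConn a₁ a₃)ᶜ ∩ ((openConn o a₂)ᶜ ∩ (openConn o a₃)ᶜ) ∩ openConn a₁ o) = p₁ * (prodBernoulli w).real ((openConn a₁ a₂)ᶜ ∩ (openConn a₁ a₃)ᶜ ∩ ((openConn o a₂)ᶜ ∩ (openConn o a₃)ᶜ)) := by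
    rcases eq_or_lt_of_le (measureReal_nonneg (μ := prodBernoulli w)
      (s := (openConn a₁ a₂)ᶜ ∩ (openConn a₁ a₃)ᶜ ∩ ((openConn o a₂)ᶜ ∩ (openConn o a₃)ᶜ))) with hz | hpos
    · have hle : (prodBernoulli w).real ((openConn a₁ a₂)ᶜ ∩ (openConn a₁ a₃)ᶜ ∩ ((openConn o a₂)ᶜ ∩ (openConn o a₃)ᶜ) ∩ openConn a₁ o) ≤ (prodBernoulli w).real ((openConn a₁ a₂)ᶜ ∩ (openConn a₁ a₃)ᶜ ∩ ((openConn o a₂)ᶜ ∩ (openConn o a₃)ᶜ)) := measureReal_mono Set.inter_subset_left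
      have h0 : 0 ≤ (prodBernoulli w).real ((openConn a₁ a₂)ᶜ ∩ (openConn a₁ a₃)ᶜ ∩ ((openConn o a₂)ᶜ ∩ (openConn o a₃)ᶜ) ∩ openConn a₁ o) := measureReal_nonneg
      rw [← hz, mul_zero]; linarith
    · rw [hp₁def, div_mul_cancel₀ _ hpos.ne']
  set p₂ := (prodBernoulli w).real ((openConn a₂ a₁)ᶜ ∩ (openConn a₂ a₃)ᶜ ∩ ((openConn o a₁)ᶜ ∩ (openConn o a₃)ᶜ) ∩ openConn a₂ o) /
    (prodBernoulli w).real ((openConn a₂ a₁)ᶜ ∩ (openConn a₂ a₃)ᶜ ∩ ((openConn o a₁)ᶜ ∩ (openConn o a₃)ᶜ)) with hp₂def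
  have hp₂0 : 0 ≤ p₂ := div_nonneg measureReal_nonneg measureReal_nonneg
  have hp₂le : p₂ ≤ 3 / 4 := by
    rcases eq_or_lt_of_le (measureReal_nonneg (μ := prodBernoulli w)
      (s := (openConn a₂ a₁)ᶜ ∩ (openConn a₂ a₃)ᶜ ∩ ((openConn o a₁)ᶜ ∩ (openConn o a₃)ᶜ))) with hz | hpos
    · rw [hp₂def, ← hz, div_zero]; norm_num
    · rw [hp₂def, div_le_iff₀ hpos]; linarith
  have hidp₂ : (prodBernoulli w).real ((openConn a₂ a₁)ᶜ ∩ (openConn a₂ a₃)ᶜ ∩ ((openConn o a₁)ᶜ ∩ (openConn o a₃)ᶜ) ∩ openConn a₂ o) = p₂ * (prodBernoulli w).real ((openConn a₂ a₁)ᶜ ∩ (openConn a₂ a₃)ᶜ ∩ ((openConn o a₁)ᶜ ∩ (openConn o a₃)ᶜ)) := by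
    rcases eq_or_lt_of_le (measureReal_nonneg (μ := prodBernoulli w)
      (s := (openConn a₂ a₁)ᶜ ∩ (openConn a₂ a₃)ᶜ ∩ ((openConn o a₁)ᶜ ∩ (openConn o a₃)ᶜ))) with hz | hpos
    · have hle : (prodBernoulli w).real ((openConn a₂ a₁)ᶜ ∩ (openConn a₂ a₃)ᶜ ∩ ((openConn o a₁)ᶜ ∩ (openConn o a₃)ᶜ) ∩ openConn a₂ o) ≤ (prodBernoulli w).real ((openConn a₂ a₁)ᶜ ∩ (openConn a₂ a₃)ᶜ ∩ ((openConn o a₁)ᶜ ∩ (openConn o a₃)ᶜ)) := measureReal_mono Set.inter_subset_left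
      have h0 : 0 ≤ (prodBernoulli w).real ((openConn a₂ a₁)ᶜ ∩ (openConn a₂ a₃)ᶜ ∩ ((openConn o a₁)ᶜ ∩ (openConn o a₃)ᶜ) ∩ openConn a₂ o) := measureReal_nonneg
      rw [← hz, mul_zero]; linarith
    · rw [hp₂def, div_mul_cancel₀ _ hpos.ne']
  set p₃ := (prodBernoulli w).real ((openConn a₃ a₁)ᶜ ∩ (openConn a₃ a₂)ᶜ ∩ ((openConn o a₁)ᶜ ∩ (openConn o a₂)ᶜ) ∩ openConn a₃ o) /
    (prodBernoulli w).real ((openConn a₃ a₁)ᶜ ∩ (openConn a₃ a₂)ᶜ ∩ ((openConn o a₁)ᶜ ∩ (openConn o a₂)ᶜ)) with hp₃def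
  have hp₃0 : 0 ≤ p₃ := div_nonneg measureReal_nonneg measureReal_nonneg
  have hp₃le : p₃ ≤ 3 / 4 := by
    rcases eq_or_lt_of_le (measureReal_nonneg (μ := prodBernoulli w)
      (s := (openConn a₃ a₁)ᶜ ∩ (openConn a₃ a₂)ᶜ ∩ ((openConn o a₁)ᶜ ∩ (openConn o a₂)ᶜ))) with hz | hpos
    · rw [hp₃def, ← hz, div_zero]; norm_num
    · rw [hp₃def, div_le_iff₀ hpos]; linarith
  have hidp₃ : (prodBernoulli w).real ((openConn a₃ a₁)ᶜ ∩ (openConn a₃ a₂)ᶜ ∩ ((openConn o a₁)ᶜ ∩ (openConn o a₂)ᶜ) ∩ openConn a₃ o) = p₃ * (prodBernoulli w).real ((openConn a₃ a₁)ᶜ ∩ (openConn a₃ a₂)ᶜ ∩ ((openConn o a₁)ᶜ ∩ (openConn o a₂)ᶜ)) := by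
    rcases eq_or_lt_of_le (measureReal_nonneg (μ := prodBernoulli w)
      (s := (openConn a₃ a₁)ᶜ ∩ (openConn a₃ a₂)ᶜ ∩ ((openConn o a₁)ᶜ ∩ (openConn o a₂)ᶜ))) with hz | hpos
    · have hle : (prodBernoulli w).real ((openConn a₃ a₁)ᶜ ∩ (openConn a₃ a₂)ᶜ ∩ ((openConn o a₁)ᶜ ∩ (openConn o a₂)ᶜ) ∩ openConn a₃ o) ≤ (prodBernoulli w).real ((openConn a₃ a₁)ᶜ ∩ (openConn a₃ a₂)ᶜ ∩ ((openConn o a₁)ᶜ ∩ (openConn o a₂)ᶜ)) := measureReal_mono Set.inter_subset_left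
      have h0 : 0 ≤ (prodBernoulli w).real ((openConn a₃ a₁)ᶜ ∩ (openConn a₃ a₂)ᶜ ∩ ((openConn o a₁)ᶜ ∩ (openConn o a₂)ᶜ) ∩ openConn a₃ o) := measureReal_nonneg
      rw [← hz, mul_zero]; linarith
    · rw [hp₃def, div_mul_cancel₀ _ hpos.ne']
  set p₁₂ := (prodBernoulli w).real ((openConn a₁ a₃)ᶜ ∩ (openConn a₂ a₃)ᶜ ∩ (openConn o a₃)ᶜ ∩ (openConn a₁ o ∪ openConn a₂ o)) /
    (prodBernoulli w).real ((openConn a₁ a₃)ᶜ ∩ (openConn a₂ a₃)ᶜ ∩ (openConn o a₃)ᶜ) with hp₁₂def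
  have hp₁₂0 : 0 ≤ p₁₂ := div_nonneg measureReal_nonneg measureReal_nonneg
  have hp₁₂le : p₁₂ ≤ 1 / 2 := by
    rcases eq_or_lt_of_le (measureReal_nonneg (μ := prodBernoulli w)
      (s := (openConn a₁ a₃)ᶜ ∩ (openConn a₂ a₃)ᶜ ∩ (openConn o a₃)ᶜ)) with hz | hpos
    · rw [hp₁₂def, ← hz, div_zero]; norm_num
    · rw [hp₁₂def, div_le_iff₀ hpos]; linarith
  have hidp₁₂ : (prodBernoulli w).real ((openConn a₁ a₃)ᶜ ∩ (openConn a₂ a₃)ᶜ ∩ (openConn o a₃)ᶜ ∩ (openConn a₁ o ∪ openConn a₂ o)) = p₁₂ * (prodBernoulli w).real ((openConn a₁ a₃)ᶜ ∩ (openConn a₂ a₃)ᶜ ∩ (openConn o a₃)ᶜ) := by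
    rcases eq_or_lt_of_le (measureReal_nonneg (μ := prodBernoulli w)
      (s := (openConn a₁ a₃)ᶜ ∩ (openConn a₂ a₃)ᶜ ∩ (openConn o a₃)ᶜ)) with hz | hpos
    · have hle : (prodBernoulli w).real ((openConn a₁ a₃)ᶜ ∩ (openConn a₂ a₃)ᶜ ∩ (openConn o a₃)ᶜ ∩ (openConn a₁ o ∪ openConn a₂ o)) ≤ (prodBernoulli w).real ((openConn a₁ a₃)ᶜ ∩ (openConn a₂ a₃)ᶜ ∩ (openConn o a₃)ᶜ) := measureReal_mono Set.inter_subset_left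
      have h0 : 0 ≤ (prodBernoulli w).real ((openConn a₁ a₃)ᶜ ∩ (openConn a₂ a₃)ᶜ ∩ (openConn o a₃)ᶜ ∩ (openConn a₁ o ∪ openConn a₂ o)) := measureReal_nonneg
      rw [← hz, mul_zero]; linarith
    · rw [hp₁₂def, div_mul_cancel₀ _ hpos.ne']
  have hpt := fun ω => chartP_pointwise n o b a₁ a₂ a₃ p₁ hp₁0 hp₁le p₂ hp₂0 hp₂le p₃ hp₃0 hp₃le p₁₂ hp₁₂0 hp₁₂le ω
  have hint := stub_lincombIntegral_c7 n w _ hpt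
  simp only [List.map_cons, List.map_nil, List.sum_cons, List.sum_nil, add_zero] at hint
  have g0 := chart_crossAll w o b a₁ a₂ a₃ h12 h13 ho2 ho3
  rw [← hp₁def] at g0
  have g1 := chart_crossAll w o b a₂ a₁ a₃ h12.symm h23 ho1 ho3
  rw [← hp₂def] at g1
  have g2 := chartP_diagOne w o b a₃ a₁ a₂ h13.symm h23.symm ho1 ho2
  rw [← hp₃def] at g2
  have e0 := stub_exchangeHas_c7 n w a₁ a₂ o b hτ12
  have e1 := stub_exchangeAvoid_c7 n w a₁ a₂ o b hτ12
  have e2 := stub_exchangePlain_c7 n w a₃ a₁ b hτ31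
  have e3 := stub_exchangeHas_c7 n w a₃ a₁ o b hτ31
  have e4 := stub_exchangeAvoid_c7 n w a₃ a₁ o b hτ31
  have e5 := stub_exchangeHas_c7 n w a₃ a₂ o b hτ32
  have e6 := stub_exchangeAvoid_c7 n w a₃ a₂ o b hτ32
  nlinarith [hint, g0, g1, g2, e0, e1, e2, e3, e4, e5, e6, hidp₁, hidp₂, hidp₃, hidp₁₂, hreg]

end Summit.CriticalPhenomena.PercolationContinuityZ3.Theorems
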